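import Summits.Parity.GeneralizedHardyLittlewood.Theorems.BeyondDiagonalBeatsQuarter.KernelFormXSqCore
import Literature.NumberTheory.LFunctions.KMVSelbergCoordinatesBridge
import HarnessLib

/-!
# The `X²` kernel form in Selberg coordinates: `Σ x x K = ℓ⁻⁴·Σ_n φ(n)W(n)²((L+κ(n))S_n² + 2S_n·P_n)`

Supports stmt-Parity-20343 (`PrimeLevelFamEdge.BeyondDiagonalBeatsQuarter`, K_B; line
`diagonal_kernel_split`, registered stub `stub_kernelFormXSq`). A helper; it closes nothing. Namespace
`Summit.Parity.GeneralizedHardyLittlewood.Theorems.BeyondDiagonalBeatsQuarter.KernelFormXSq`.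

The tree's bridge identity `Σ_{a,b≤M} x_a x_b K(a,b) = F_{M,L}(A(x))`
(`KMV2000.SelbergCoord.quadForm_kmvKernel_eq_scForm`, with the Selberg coordinates
`A_n(x) = Σ_{n∣m≤M} τ(m/n)x_m/m`) is specialised to the KMV `X²`-profile coefficients
`x_m = μ(m)ψ(m)⁻¹(log(M/m)/log M)²` (`xsq M m`):

* `selA_xsq` — `A_n(x) = W(n)·S(M/n;n)/log²M` with `S = coprimeSum` (`KernelFormXSqCore`),
  `W = μ/(id·ψ)`;
* `sum_wt_selA_xsq` — the von Mangoldt coupling collapses to primes: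
  `Σ_m w(n,m)A_m = −φ(n)W(n)·P_n/log²M`, `P_n = Σ_{p ≤ M/n, p∤n} (log p/(p+1))·S(M/(np);np)` (`primeSum`);
* `quadForm_xsq_eq` — **`Σ_{a,b ≤ M} x_a x_b K_L(a,b) =
  (Σ_{n ≤ M} φ(n)W(n)²((L + κ(n))S_n² + 2 S_n P_n))/log⁴M`**.

Two bookkeeping definitions (`xsq`, `primeSum`); everything is PROVED.

## References
* E. Kowalski, P. Michel, J. VanderKam, J. reine angew. Math. 526 (2000), (21)–(23) pp. 12–13 and
  Prop. 5.1 p. 18. [cite: KowalskiMichelVanderKam2000, (21)–(23) — derivation]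
«The programme SEARCHES and TYPES; no claim about Landau–Siegel zeros, Theorems 1–2 of
arXiv:2211.02515 or a repaired Margin232 until a kernel theorem says so.»
-/

noncomputable section

open scoped Real ArithmeticFunction.Moebius ArithmeticFunction.sigma ArithmeticFunction.zeta
open Finset ArithmeticFunction

namespace Summit.Parity.GeneralizedHardyLittlewood.Theorems.BeyondDiagonalBeatsQuarter.KernelFormXSq

open Literature.NumberTheory.LFunctions Literature.NumberTheory.LFunctions.KMV2000
open MollifierMainTerm (W G invA)
open SelbergCoord (kappa wt scForm selA tauR quadForm_kmvKernel_eq_scForm)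

/-! ### The `X²` coefficients and `W` -/

/-- The KMV mollifier coefficient at the profile `X²`: `x_m = μ(m)ψ(m)⁻¹(log(M/m)/log M)²`.
[cite: KowalskiMichelVanderKam2000, (9) p. 7 — derivation (bookkeeping abbreviation, `P = X²`)] -/
def xsq (M : ℝ) (m : ℕ) : ℝ := (μ m : ℝ) * ((psi m)⁻¹ * (Real.log (M / m) / Real.log M) ^ 2)

/-- Unfolding `W(m) = μ(m)ψ(m)⁻¹m⁻¹` for `m ≠ 0`. [folklore] -/
theorem W_apply'' {m : ℕ} (hm : m ≠ 0) : W m = (μ m : ℝ) * ((psi m)⁻¹ * (m : ℝ)⁻¹) := by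
  simp only [W, pmul_apply, intCoe_apply, invA_apply', prodPrimeFactors_apply hm, psi,
    Finset.prod_inv_distrib]
  ring

/-- `W` vanishes off the squarefree numbers. [folklore] -/
theorem W_eq_zero_of_not_squarefree {m : ℕ} (hm : ¬ Squarefree m) : W m = 0 := by
  rcases eq_or_ne m 0 with rfl | hm0
  · simp
  · rw [W_apply'' hm0, ArithmeticFunction.moebius_eq_zero_of_not_squarefree hm]; simp

/-- `|W(n)| = μ(n)·W(n)`. [folklore] -/
theorem abs_W_eq (n : ℕ) : |W n| = (μ n : ℝ) * W n := by
  rcases eq_or_ne n 0 with rfl | hn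
  · simp
  rw [W_apply'' hn]
  have hc : 0 < (psi n)⁻¹ * (n : ℝ)⁻¹ := by
    have : 0 < psi n := Finset.prod_pos fun p _ ↦ by positivity
    positivity
  have key : |(μ n : ℝ)| = (μ n : ℝ) * (μ n : ℝ) := by
    rcases ArithmeticFunction.moebius_eq_or n with h | h | h <;> simp [h]
  rw [abs_mul, abs_of_pos hc, key]
  ring

/-- `|W(n)| ≤ 1/n`. [folklore] -/
theorem abs_W_le (n : ℕ) : |W n| ≤ (n : ℝ)⁻¹ := by
  rcases eq_or_ne n 0 with rfl | hn
  · simp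
  rw [W_apply'' hn, abs_mul, abs_mul]
  have hpsi : 1 ≤ psi n := by
    unfold psi
    calc (1 : ℝ) = ∏ p ∈ n.primeFactors, (1 : ℝ) := by simp
      _ ≤ ∏ p ∈ n.primeFactors, (1 + (p : ℝ)⁻¹) :=
          Finset.prod_le_prod (fun _ _ ↦ zero_le_one) fun p _ ↦ by
            have : (0 : ℝ) ≤ (p : ℝ)⁻¹ := by positivity
            linarith
  have h1 : |(μ n : ℝ)| ≤ 1 := by exact_mod_cast ArithmeticFunction.abs_moebius_le_one
  have h2 : |(psi n)⁻¹| ≤ 1 := by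
    rw [abs_of_nonneg (by positivity)]; exact inv_le_one_of_one_le₀ hpsi
  have h3 : |((n : ℝ))⁻¹| = (n : ℝ)⁻¹ := abs_of_nonneg (by positivity)
  rw [h3]
  calc |(μ n : ℝ)| * (|(psi n)⁻¹| * (n : ℝ)⁻¹) ≤ 1 * (1 * (n : ℝ)⁻¹) := by gcongr
    _ = (n : ℝ)⁻¹ := by ring

/-- `φ(n)W(n)² ≤ 1/n` (`φ(n) ≤ n`, `|W(n)| ≤ 1/n`). [folklore] -/
theorem totient_mul_W_sq_le (n : ℕ) : (Nat.totient n : ℝ) * W n ^ 2 ≤ (n : ℝ)⁻¹ := by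
  rcases eq_or_ne n 0 with rfl | hn
  · simp
  have hn0 : (0 : ℝ) < n := by exact_mod_cast Nat.pos_of_ne_zero hn
  have h1 : (Nat.totient n : ℝ) ≤ n := by exact_mod_cast Nat.totient_le n
  have h2 : W n ^ 2 ≤ (n : ℝ)⁻¹ ^ 2 := by
    rw [← sq_abs]; exact pow_le_pow_left₀ (abs_nonneg _) (abs_W_le n) 2
  calc (Nat.totient n : ℝ) * W n ^ 2 ≤ n * (n : ℝ)⁻¹ ^ 2 :=
        mul_le_mul h1 h2 (sq_nonneg _) hn0.le
    _ = (n : ℝ)⁻¹ := by field_simp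

/-! ### Reindexing over multiples -/

/-- `Σ_{m ≤ N, n∣m} F(m) = Σ_{j ≤ N/n} F(nj)` for `n ≥ 1`. [folklore] -/
theorem sum_Icc_ite_dvd_eq {β : Type*} [AddCommMonoid β] {n : ℕ} (hn : n ≠ 0) (N : ℕ) (F : ℕ → β) :
    ∑ m ∈ Icc 1 N, (if n ∣ m then F m else 0) = ∑ j ∈ Icc 1 (N / n), F (n * j) := by
  rw [← Finset.sum_filter]
  have hsub : (Icc 1 N).filter (fun m ↦ n ∣ m) = (Icc 1 (N / n)).image (fun j ↦ n * j) := by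
    ext m
    simp only [Finset.mem_filter, Finset.mem_Icc, Finset.mem_image]
    constructor
    · rintro ⟨⟨hm1, hmN⟩, ⟨j, rfl⟩⟩
      refine ⟨j, ⟨?_, ?_⟩, rfl⟩
      · rcases Nat.eq_zero_or_pos j with rfl | hj
        · omega
        · exact hj
      · exact (Nat.le_div_iff_mul_le (Nat.pos_of_ne_zero hn)).2 (by rwa [mul_comm] at hmN)
    · rintro ⟨j, ⟨hj1, hjN⟩, rfl⟩
      refine ⟨⟨Nat.one_le_iff_ne_zero.2 (mul_ne_zero hn (by omega)), ?_⟩, dvd_mul_right n j⟩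
      have := (Nat.le_div_iff_mul_le (Nat.pos_of_ne_zero hn)).1 hjN
      rwa [mul_comm] at this
  rw [hsub, Finset.sum_image fun j _ k _ h ↦ (Nat.mul_right_inj hn).1 h]

/-! ### The Selberg coordinates of the `X²` mollifier -/

/-- `τ(j)·x_{nj}/(nj) = W(n)·f_n(j)·(log((M/n)/j)/log M)²` for `n, j ≥ 1` (`f_n = τW1_{(·,n)=1}`):
`W(nj) = W(n)W(j)` for `(n,j) = 1` and `= 0` otherwise. [cite: KowalskiMichelVanderKam2000, (23) — derivation] -/
theorem tauR_mul_xsq_div (M : ℝ) {n j : ℕ} (hn : n ≠ 0) (hj : j ≠ 0) :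
    tauR (n * j / n) * (xsq M (n * j) / ((n * j : ℕ) : ℝ)) =
      W n * (copTauW n j * (Real.log (M / n / j) / Real.log M) ^ 2) := by
  rw [Nat.mul_div_cancel_left j (Nat.pos_of_ne_zero hn), copTauW_apply]
  have hW : xsq M (n * j) / ((n * j : ℕ) : ℝ) = W (n * j) * (Real.log (M / ((n * j : ℕ) : ℝ)) / Real.log M) ^ 2 := by
    rw [W_apply'' (mul_ne_zero hn hj), xsq]
    have : ((n * j : ℕ) : ℝ) ≠ 0 := by exact_mod_cast mul_ne_zero hn hj
    field_simp
  rw [hW]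
  have hlog : Real.log (M / ((n * j : ℕ) : ℝ)) = Real.log (M / n / j) := by
    push_cast; rw [div_div]
  rw [hlog]
  by_cases hc : j.Coprime n
  · rw [if_pos hc, isMultiplicative_W'.map_mul_of_coprime hc.symm, tauR]
    ring
  · rw [if_neg hc]
    have hns : ¬ Squarefree (n * j) := fun h ↦ hc (Nat.coprime_of_squarefree_mul h).symm
    rw [W_eq_zero_of_not_squarefree hns]
    ring

/-- **`A_n(x) = W(n)·S(M/n;n)/log²M`** for the `X²` coefficients (`n ≥ 1`).
[cite: KowalskiMichelVanderKam2000, (23) — derivation (Selberg coordinates of the X² mollifier)] -/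
theorem selA_xsq (M : ℝ) {n : ℕ} (hn : n ≠ 0) :
    selA ⌊M⌋₊ (xsq M) n = W n * coprimeSum n (M / n) / Real.log M ^ 2 := by
  unfold selA coprimeSum
  rw [sum_Icc_ite_dvd_eq hn, ← Nat.floor_div_natCast, Finset.mul_sum, Finset.sum_div]
  refine Finset.sum_congr rfl fun j hj ↦ ?_
  have hj0 : j ≠ 0 := by have := (Finset.mem_Icc.1 hj).1; omega
  rw [tauR_mul_xsq_div M hn hj0, div_pow]
  ring

/-! ### The von Mangoldt coupling collapses to primes -/

/-- `Λ(j)·W(nj) = −(log j/(j+1))·W(n)` if `j` is a prime not dividing `n`, and `0` otherwise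
(`W` lives on squarefree numbers). [folklore] -/
theorem vonMangoldt_mul_W_mul {n j : ℕ} (hn : n ≠ 0) :
    Λ j * W (n * j) = if j.Prime ∧ ¬ j ∣ n then -(Real.log j / ((j : ℝ) + 1)) * W n else 0 := by
  by_cases hpp : IsPrimePow j
  · obtain ⟨p, k, hp, hk, rfl⟩ := hpp
    have hp' : p.Prime := Nat.prime_iff.2 hp
    rcases eq_or_ne k 1 with rfl | hk1
    · -- `j = p`
      rw [pow_one]
      by_cases hpn : p ∣ n
      · rw [if_neg (fun h ↦ h.2 hpn)]
        have hns : ¬ Squarefree (n * p) := by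
          obtain ⟨c, rfl⟩ := hpn
          intro h
          have := h p ⟨c, by ring⟩
          exact hp'.not_isUnit this
        rw [W_eq_zero_of_not_squarefree hns, mul_zero]
      · rw [if_pos ⟨hp', hpn⟩, vonMangoldt_apply_prime hp',
          isMultiplicative_W'.map_mul_of_coprime ((Nat.Prime.coprime_iff_not_dvd hp').2 hpn).symm]
        have hWp : W p = -((p : ℝ) + 1)⁻¹ := by
          have := W_apply_prime_pow' (i := 1) hp' one_ne_zero
          rw [pow_one] at this; rw [this, if_pos rfl]
        rw [hWp]
        ring
    · -- `j = p^k`, `k ≥ 2`: not squarefree, not prime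
      have hk2' : 2 ≤ k := by omega
      have hnotprime : ¬ (p ^ k).Prime := Nat.Prime.not_prime_pow' (by omega)
      rw [if_neg (fun h ↦ hnotprime h.1)]
      have hns : ¬ Squarefree (n * p ^ k) := by
        intro h
        have : p * p ∣ n * p ^ k := by
          refine Dvd.dvd.mul_left ?_ n
          rw [← pow_two]; exact pow_dvd_pow p hk2'
        exact hp'.not_isUnit (h p this)
      rw [W_eq_zero_of_not_squarefree hns, mul_zero]
  · rw [vonMangoldt_apply, if_neg hpp, zero_mul, if_neg]
    rintro ⟨hj, -⟩
    exact hpp hj.isPrimePow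

/-- `P_n = Σ_{p ≤ ⌊M⌋/n, p prime, p ∤ n} (log p/(p+1))·S(M/(np); np)`: the prime sum of the
von Mangoldt coupling. [cite: KowalskiMichelVanderKam2000, (23) — derivation (bookkeeping abbreviation)] -/
def primeSum (M : ℝ) (n : ℕ) : ℝ :=
  ∑ j ∈ Icc 1 (⌊M⌋₊ / n), if j.Prime ∧ ¬ j ∣ n then
    Real.log j / ((j : ℝ) + 1) * coprimeSum (n * j) (M / ((n * j : ℕ) : ℝ)) else 0

/-- **The von Mangoldt coupling of the `X²` Selberg coordinates**:
`Σ_{m ≤ M} w(n,m)·A_m = −φ(n)W(n)·P_n/log²M` (`n ≥ 1`). [cite: KowalskiMichelVanderKam2000, (23) — derivation] -/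
theorem sum_wt_selA_xsq (M : ℝ) {n : ℕ} (hn : n ≠ 0) :
    ∑ m ∈ Icc 1 ⌊M⌋₊, wt n m * selA ⌊M⌋₊ (xsq M) m =
      -((Nat.totient n : ℝ) * W n * primeSum M n / Real.log M ^ 2) := by
  have h1 : ∀ m ∈ Icc 1 ⌊M⌋₊, wt n m * selA ⌊M⌋₊ (xsq M) m =
      if n ∣ m then (Nat.totient n : ℝ) * Λ (m / n) * selA ⌊M⌋₊ (xsq M) m else 0 := by
    intro m hm
    unfold wt
    by_cases hnm : n ∣ m
    · by_cases hlt : n < m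
      · rw [if_pos ⟨hnm, hlt⟩, if_pos hnm]
      · have hmn : m = n := by
          have := Nat.le_of_dvd (by have := (Finset.mem_Icc.1 hm).1; omega) hnm
          omega
        subst hmn
        rw [if_neg (fun h ↦ hlt h.2), if_pos hnm, Nat.div_self (Nat.pos_of_ne_zero hn),
          vonMangoldt_apply_one]
        ring
    · rw [if_neg (fun h ↦ hnm h.1), if_neg hnm, zero_mul]
  rw [Finset.sum_congr rfl h1, sum_Icc_ite_dvd_eq hn, primeSum, Finset.mul_sum, Finset.sum_div,
    ← Finset.sum_neg_distrib]
  refine Finset.sum_congr rfl fun j hj ↦ ?_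
  have hj0 : j ≠ 0 := by have := (Finset.mem_Icc.1 hj).1; omega
  rw [Nat.mul_div_cancel_left j (Nat.pos_of_ne_zero hn), selA_xsq M (mul_ne_zero hn hj0)]
  have key := vonMangoldt_mul_W_mul (j := j) hn
  have hre : (Nat.totient n : ℝ) * Λ j * (W (n * j) * coprimeSum (n * j) (M / ((n * j : ℕ) : ℝ)) /
      Real.log M ^ 2) = (Nat.totient n : ℝ) * (Λ j * W (n * j)) *
        coprimeSum (n * j) (M / ((n * j : ℕ) : ℝ)) / Real.log M ^ 2 := by ring
  rw [hre, key]
  by_cases hc : j.Prime ∧ ¬ j ∣ n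
  · rw [if_pos hc, if_pos hc]; ring
  · rw [if_neg hc, if_neg hc]; ring

/-! ### The kernel form in Selberg coordinates -/

/-- **The `X²` kernel form in Selberg coordinates.** For `M ≥ 0` and every `L`:
`Σ_{a,b ≤ M} x_a x_b K_L(a,b) = (Σ_{n ≤ M} φ(n)W(n)²·((L + κ(n))·S_n² + 2·S_n·P_n))/log⁴M`,
`S_n = S(M/n;n)` (any real `M`; for `M < 1` both sides vanish). [cite: KowalskiMichelVanderKam2000, (21)–(23) and Prop. 5.1 — derivation] -/
theorem quadForm_xsq_eq (M L : ℝ) :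
    ∑ a ∈ Icc 1 ⌊M⌋₊, ∑ b ∈ Icc 1 ⌊M⌋₊, xsq M a * xsq M b * kmvKernel L a b =
      (∑ n ∈ Icc 1 ⌊M⌋₊, (Nat.totient n : ℝ) * W n ^ 2 *
        ((L + kappa n) * coprimeSum n (M / n) ^ 2 + 2 * (coprimeSum n (M / n) * primeSum M n))) /
        Real.log M ^ 4 := by
  rw [quadForm_kmvKernel_eq_scForm, scForm]
  set ℓ : ℝ := Real.log M with hℓ
  have hT1 : ∑ n ∈ Icc 1 ⌊M⌋₊, (Nat.totient n : ℝ) * (L + kappa n) * selA ⌊M⌋₊ (xsq M) n ^ 2 =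
      (∑ n ∈ Icc 1 ⌊M⌋₊, (Nat.totient n : ℝ) * W n ^ 2 * ((L + kappa n) * coprimeSum n (M / n) ^ 2)) /
        ℓ ^ 4 := by
    rw [Finset.sum_div]
    refine Finset.sum_congr rfl fun n hn ↦ ?_
    have hn0 : n ≠ 0 := by have := (Finset.mem_Icc.1 hn).1; omega
    rw [selA_xsq M hn0]
    ring
  have hT2 : ∑ n ∈ Icc 1 ⌊M⌋₊, ∑ m ∈ Icc 1 ⌊M⌋₊, wt n m * selA ⌊M⌋₊ (xsq M) n * selA ⌊M⌋₊ (xsq M) m =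
      -(∑ n ∈ Icc 1 ⌊M⌋₊, (Nat.totient n : ℝ) * W n ^ 2 * (coprimeSum n (M / n) * primeSum M n)) /
        ℓ ^ 4 := by
    rw [neg_div, Finset.sum_div, ← Finset.sum_neg_distrib]
    refine Finset.sum_congr rfl fun n hn ↦ ?_
    have hn0 : n ≠ 0 := by have := (Finset.mem_Icc.1 hn).1; omega
    have hre : ∑ m ∈ Icc 1 ⌊M⌋₊, wt n m * selA ⌊M⌋₊ (xsq M) n * selA ⌊M⌋₊ (xsq M) m =
        selA ⌊M⌋₊ (xsq M) n * ∑ m ∈ Icc 1 ⌊M⌋₊, wt n m * selA ⌊M⌋₊ (xsq M) m := by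
      rw [Finset.mul_sum]
      exact Finset.sum_congr rfl fun m _ ↦ by ring
    rw [hre, sum_wt_selA_xsq M hn0, selA_xsq M hn0]
    ring
  rw [hT1, hT2]
  have : ∀ n ∈ Icc 1 ⌊M⌋₊, (Nat.totient n : ℝ) * W n ^ 2 *
      ((L + kappa n) * coprimeSum n (M / n) ^ 2 + 2 * (coprimeSum n (M / n) * primeSum M n)) =
      (Nat.totient n : ℝ) * W n ^ 2 * ((L + kappa n) * coprimeSum n (M / n) ^ 2) +
        2 * ((Nat.totient n : ℝ) * W n ^ 2 * (coprimeSum n (M / n) * primeSum M n)) := by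
    intro n _; ring
  rw [Finset.sum_congr rfl this, Finset.sum_add_distrib, ← Finset.mul_sum]
  ring

end Summit.Parity.GeneralizedHardyLittlewood.Theorems.BeyondDiagonalBeatsQuarter.KernelFormXSq
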